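import Literature.MathematicalPhysics.QuantumFieldTheory.Balaban1983to89.Node00.ShearedDatumCentred
import Literature.MathematicalPhysics.QuantumFieldTheory.Balaban1983to89.Node00.ShearedAveragingRecord
import Literature.MathematicalPhysics.QuantumFieldTheory.Balaban1983to89.Node00.Record11
import Literature.MathematicalPhysics.QuantumFieldTheory.Balaban1983to89.T4AxialGaugeSmallField
import Summits.QuantumFields.YangMills.Theorems.BalabanUVNodesN07ShearDatumBCH
import Summits.QuantumFields.BalabanUV.T4Continuum.Support.B13AvgCorrStokesLoop
import HarnessLib

/-!
# DAG node N07 [B11] — road R0′'s row (r4) «CENTRED SHEAR» AT THE RECORD: the window is a BOX of the torus `T^{(j)}` (the top cube of [B11] (144) ∕ `Node00.cubeDomains`), reached from its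
# corner by coordinate walks of at most `D = Σ_κ(hi_κ − lo_κ)` steps, so dag-n07-e's `dist1_centredShear_le_of_reach` gives the shear size `σ♮ ≤ D·(v + a)` on the box; with the record's
# `SU(N) ⊂ M_N(ℂ)` letters, the logarithms `‖log ĝ‖ ≤ 2σ♮` and the (r1) BCH split of the sheared datum with remainder `8σ♮² + 20σ♮v`

Cell `pub-ymgap` (HUMAN RULINGS D-0062 ∕ D-0088 ∕ D-0149), width seat `pub-ymgap-dag-n07-w6` g0 (second wave), 2026-08-28; lane owner dag-n07-e g20's OFFER (r4-rec) (cell bus 06:38Z (D), CLAIM-4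
bus I.30379): «the record instance of INTENT-43 (window = top box of `cubeDomains`, coordinate-walk paths as in module 40's `dist1_dataAxial_le_sharp`, `v` from (151)∕module 40, `a` from n07-w2's
`norm_chartLog_le_weightedBall` + the `chartLog = log∘M^j∘exp` line, log letters)».  `--kind proof --supports stmt-QuantumFields-20542 --as helper` (K1⁷; count-neutral).  THEOREMS ONLY.

THE PRINT.  [B11] = T. Bałaban, *The variational problem and background fields in renormalization group method for lattice gauge theories*, Commun. Math. Phys. **102** (1985) 277–309
`[Balaban1985Variational]`, Sect. F p. 300 (144) «Let us take a cube □ intersecting Ω_j … of a size 2ML^jη», p. 301 (151)–(152) («|V″ − 1| < 9dL²Mε₀ ≤ c₀ on 𝔅_k»; «there exists a unique gauge transformation u …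
Lʲη|A|, … < 9dL²B₁Mε₀»), p. 302 (154)–(156).  [3] = [Balaban1985Averaging] (11) p. 19 (covariance), (85)–(88) p. 31.  [I] = [Balaban1987RG1] (0.3) p. 252 (the staircase contours `Γ_{y,x}`: «take |n_{π(1)}| bonds in the
direction sign n_{π(1)} e_{π(1)} starting at y, …» — the coordinate walks below are these words, `T4Continuum.stairWord`).

WHAT THIS FILE DOES (lattice combinatorics + by-name composition; NOTHING of [B11]∕[6]∕[3] analysis asserted).
* §1 COORDINATE WALKS IN A BOX OF `T^{(j)}` (generic `Params`): `unshift_shift`, `exists_bond_walkEnd_take_succ` (consecutive prefix ends of ANY lattice walk are the two ends of a bond, either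
  orientation), `walkEnd_castSite`, `walkEnd_take_stairWord_mem_box` (the word length `Σ_κ|n_κ|` is the BalabanUV support lemma `B13AvgCorrStokesLoop.length_stairWord`, imported) (every prefix end of the staircase from the corner `lo` to a box point
  stays in the box, `netDisp_take_stairWord`), ★ `box_reach` — the reachability hypothesis `hreach` of dag-n07-e's window door for `W := castSite '' [lo, hi]`, centre `y₀ := castSite lo`, path-diameter
  `D := Σ_κ (hi_κ − lo_κ)`; `mem_boxBonds_of_ends_mem_box` (on a non-wrapping box a bond with both ends in `W` is a box bond of pv26's `boxBonds` — the door to module 40's `dist1_dataAxial_le`).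
* §2 ROW (r4) ON A BOX, generic averaging family ∕ gauge group (dag-n07-e's `dist1_centredShear_le_of_reach(_data)` ∘ `box_reach`): ★★ `dist1_centredShear_le_box` (`dist1 (g(y₀)⁻¹·g(y)) ≤ D·(v + a)` on the box
  from the bond letters `v` (data `M^j(U₁^u)`) and `a` (the Landau copy's averages `M^j(U₁)`)), `dist1_centredShear_le_box_data` (datum `V` displayed), `dist1_centredShear_rel_le_box` (two box sites: `≤ 2D(v+a)`).
* §3 AT THE RECORD (`avOfRecord F N K`, `SU(N) ⊂ M_N(ℂ)`, `dist1 = ‖· − 1‖_op`): ★★ `dist1_centredShear_le_box_record`; ★ `norm_mlog_centredShear_le_box_record` (log letters `‖log ĝ(y)‖ ≤ 2·D(v + a)` once `D(v + a) ≤ ½`,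
  `MatrixLog.norm_mlog_le_two_mul`); ★ `dist1_shearRIter_rel_le_box_record` (the intrinsic edition: under the axial gauges below `j` and the (1.29) normalisation at the corner and at `y`,
  `dist1 (S_j(U₁)(y₀)·S_j(U₁)(y)⁻¹) ≤ D·(v + a)` — p608036's discharges of `h𝓔`∕`hctr`).
* §4 ★★★ ROWS (r1)+(r4) COMPOSED AT THE RECORD `norm_mlog_iter_avOfRecord_centred_sub_le`: on a box bond `c`, with `σ♮ := D·(v + a) ≤ 1∕80` and `‖M^j(U′)(c) − 1‖ ≤ v ≤ 1∕40`,
  `‖log M^j(U₁)(c) − (log V♮(c) + (log ĝ(c₋)⁻¹ − log ĝ(c₊)⁻¹))‖ ≤ 8σ♮² + 20σ♮v` where `V♮(c) := g₀⁻¹·M^j(U′)(c)·g₀`, `ĝ := g₀⁻¹·u↾T^{(j)}`, `g₀ := u↾T^{(j)}(y₀)` — dag-n07-e's centred identity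
  `iter_apply_eq_centredShear` + dag-n07-w7's `norm_mlog_conj_shear_sub_le`, every letter supplied except `v` ((151) ∕ module 40) and `a` ((152) ∕ n07-w2's weighted-ball bound), which stay DISPLAYED.
* §5 (v1.1, A6) NON-VACUITY: at `U₁ = 1`, `u = 1` the bond letters hold with `v = a = 0` (`dist1_iter_avOfRecord(_gaugeAct)_one`) and the composed row's remainder bound is `0`
  (`norm_mlog_iter_avOfRecord_centred_sub_le_one`) — the hypothesis set is inhabited on every box (the referees' A2 point for this file, answered in-file).

HONEST FRAMING (binding).  Count-neutral helper; by-name composition of landed theorems (dag-n07-e p611058 `ShearedDatumCentred`, p607232 `ShearedAveragingFlat`; this seat p608036; dag-n07-w7 p609976; pv26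
`T4AxialGaugeSmallField`; b2b `BlockAveraging` words; node00-def `ιSU`); `v`, `a`, the axial gauges, the (1.29) normalisation and the box's non-wrapping are HYPOTHESES; (166♭)'s extra factor `D²` versus print's
thresholds is the lineage's DISPLAYED deviation (dag-n07-e § BRIDGE-92-B), not hidden here; the Landau copy `u` is NOT constructed ([6] Thm 2); BRIDGE-92-B stays GAP-STATED until (r1)–(r4) + records are knit by
the S6 head; tokens ∕ stub 1 ∕ K0⁷ ∕ K1⁷ NOT closed; N07 NOT discharged (typed 28∕28 · discharged 5∕27 unmoved); no summit statement is proved by this seat; one finite `T⁴` programme at fixed `ε`, Bałaban AS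
PRINTED — the route closes the conditional finite-𝕋⁴ rung `BalabanLadder.UV` only; NOT continuum ∕ ℝ⁴ ∕ OS ∕ mass gap ∕ Clay.  No `sorry`, no `def`, no `instance`, no `notation`.
-/

noncomputable section

namespace Summit.QuantumFields.YangMills.BalabanUVNodes.N07ShearSizeTopBox

open scoped Matrix.Norms.L2Operator
open Literature.MathematicalPhysics.QuantumFieldTheory.Balaban1983to89
open Literature.MathematicalPhysics.QuantumFieldTheory.Balaban1983to89.Node00
open T4Continuum
open T4AxialGaugeSmallField (castSite castSite_apply castSite_add_e boxBonds castSite_injOn_box)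
open B7Prop1Explicit (e)
open B16Sect1Backgrounds (toMS)
open GaugeField (gaugeAct)
open ExpMeanLog (expMeanLogSU)
open MatrixLog (mlog norm_mlog_le_two_mul)
open Summit.QuantumFields.YangMills.Theorems.N07ShearDatumBCH (norm_mlog_conj_shear_sub_le)
open Summit.QuantumFields.BalabanUV.T4Continuum.B13AvgCorrStokesLoop (length_stairWord)

/-! ## §1  Coordinate walks in a box of `T^{(j)}` -/

section Walks

variable {P : Params} {j : ℕ}

/-- `(x − e_ν) + e_ν = x` on the torus. [cite: Balaban1987RG1, (0.1) p.251 (bookkeeping)] -/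
theorem unshift_shift (x : Site P j) (ν : Fin P.d) : (x.unshift ν).shift ν = x := by
  funext κ
  by_cases h : κ = ν
  · subst h; simp [Site.shift, Site.unshift]
  · simp [Site.shift, Site.unshift, h]

/-- **Consecutive prefix ends of a lattice walk are the two ends of a bond** (forward letter `+e_μ`: the bond `⟨·, μ⟩` from the earlier end; backward letter: the bond into it) — the step
clause of dag-n07-e's reachability hypothesis for walks spelled by words ([I] p. 252's contours). [cite: Balaban1987RG1, (0.3) p.252] -/
theorem exists_bond_walkEnd_take_succ (x : Site P j) (w : List (Letter P.d)) {i : ℕ} (hi : i < w.length) :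
    ∃ c : PBond P j, (c.src = walkEnd x (w.take i) ∧ c.tgt = walkEnd x (w.take (i + 1))) ∨
      (c.src = walkEnd x (w.take (i + 1)) ∧ c.tgt = walkEnd x (w.take i)) := by
  rw [List.take_succ_eq_append_getElem hi, walkEnd_append]
  generalize w[i] = l
  obtain ⟨μ, b⟩ := l
  cases b
  · refine ⟨⟨(walkEnd x (w.take i)).unshift μ, μ⟩, Or.inr ⟨rfl, ?_⟩⟩
    show ((walkEnd x (w.take i)).unshift μ).shift μ = walkEnd x (w.take i)
    exact unshift_shift _ _
  · exact ⟨⟨walkEnd x (w.take i), μ⟩, Or.inl ⟨rfl, rfl⟩⟩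

/-- The end of a walk from a projected integer point is the projection of the displaced point (`walkEnd_apply`). [cite: Balaban1987RG1, (0.3) p.252 (bookkeeping)] -/
theorem walkEnd_castSite (z : Fin P.d → ℤ) (w : List (Letter P.d)) :
    walkEnd (castSite z : Site P j) w = castSite (z + fun κ => netDisp w κ) := by
  funext κ
  rw [walkEnd_apply, castSite_apply, castSite_apply, Pi.add_apply, Int.cast_add]

/-- Every prefix end of the staircase from the corner `lo` to a box point `t ∈ [lo, hi]` stays in the box (`netDisp_take_stairWord`: prefix displacements lie in `[0, t − lo]`).
[cite: Balaban1987RG1, (0.3) p.252] -/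
theorem walkEnd_take_stairWord_mem_box {lo hi t : Fin P.d → ℤ} (hlo : lo ≤ t) (hhi : t ≤ hi) (σ : Equiv.Perm (Fin P.d)) (m : ℕ) :
    walkEnd (castSite lo : Site P j) ((stairWord σ (t - lo)).take m) ∈ (castSite '' Set.Icc lo hi : Set (Site P j)) := by
  rw [walkEnd_castSite]
  refine ⟨_, ⟨fun κ => ?_, fun κ => ?_⟩, rfl⟩
  · have h := (netDisp_take_stairWord σ (t - lo) κ m).1
    have e1 : (t - lo) κ = t κ - lo κ := rfl
    have h1 : lo κ ≤ t κ := hlo κ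
    have hmin : min 0 (t κ - lo κ) = 0 := min_eq_left (by omega)
    rw [e1, hmin] at h
    show lo κ ≤ lo κ + netDisp ((stairWord σ (t - lo)).take m) κ
    omega
  · have h := (netDisp_take_stairWord σ (t - lo) κ m).2
    have e1 : (t - lo) κ = t κ - lo κ := rfl
    have h1 : lo κ ≤ t κ := hlo κ
    have h2 : t κ ≤ hi κ := hhi κ
    have hmax : max 0 (t κ - lo κ) = t κ - lo κ := max_eq_right (by omega)
    rw [e1, hmax] at h
    show lo κ + netDisp ((stairWord σ (t - lo)).take m) κ ≤ hi κ
    omega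

/-- ★ **A BOX OF THE TORUS IS REACHED FROM ITS CORNER BY COORDINATE WALKS OF AT MOST `Σ_κ(hi_κ − lo_κ)` STEPS INSIDE THE BOX** — the reachability hypothesis `hreach` of dag-n07-e's
`Node00.dist1_centredShear_le_of_reach` for the window `W := castSite '' [lo, hi]`, the centre `y₀ := castSite lo` and the path-diameter `D := Σ_κ (hi_κ − lo_κ)`: for `y = castSite t` take the
staircase word of offset `t − lo` ([I] p. 252), whose prefix ends stay in the box. [cite: Balaban1987RG1, (0.3) p.252; Balaban1985Variational, (144) p.300] -/
theorem box_reach {lo hi : Fin P.d → ℤ} :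
    ∀ y ∈ (castSite '' Set.Icc lo hi : Set (Site P j)), ∃ n ≤ ∑ κ, (hi κ - lo κ).toNat, ∃ γ : ℕ → Site P j,
      γ 0 = castSite lo ∧ γ n = y ∧
        ∀ i, i < n → ∃ c : PBond P j, ((c.src = γ i ∧ c.tgt = γ (i + 1)) ∨ (c.src = γ (i + 1) ∧ c.tgt = γ i)) ∧
          c.src ∈ (castSite '' Set.Icc lo hi : Set (Site P j)) ∧ c.tgt ∈ (castSite '' Set.Icc lo hi : Set (Site P j)) := by
  rintro y ⟨t, ⟨hlo, hhi⟩, rfl⟩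
  set w : List (Letter P.d) := stairWord (Equiv.refl (Fin P.d)) (t - lo) with hw
  refine ⟨w.length, ?_, fun i => walkEnd (castSite lo) (w.take i), rfl, ?_, fun i hlt => ?_⟩
  · rw [hw, length_stairWord]
    refine Finset.sum_le_sum fun κ _ => ?_
    have h1 : lo κ ≤ t κ := hlo κ
    have h2 : t κ ≤ hi κ := hhi κ
    have e1 : (t - lo) κ = t κ - lo κ := rfl
    show ((t - lo) κ).natAbs ≤ (hi κ - lo κ).toNat
    rw [e1]
    have hz : ((t κ - lo κ).natAbs : ℤ) ≤ ((hi κ - lo κ).toNat : ℤ) := by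
      rw [Int.natAbs_of_nonneg (by omega), Int.toNat_of_nonneg (by omega)]
      omega
    exact_mod_cast hz
  · show walkEnd (castSite lo) (w.take w.length) = castSite t
    rw [List.take_length, walkEnd_castSite]
    congr 1
    funext κ
    rw [Pi.add_apply, hw, netDisp_stairWord, Pi.sub_apply]
    ring
  · obtain ⟨c, hc⟩ := exists_bond_walkEnd_take_succ (castSite lo) w hlt
    have hm : ∀ m, walkEnd (castSite lo : Site P j) (w.take m) ∈ (castSite '' Set.Icc lo hi : Set (Site P j)) :=
      fun m => walkEnd_take_stairWord_mem_box hlo hhi _ m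
    refine ⟨c, hc, ?_, ?_⟩
    · rcases hc with ⟨hs, -⟩ | ⟨hs, -⟩ <;> rw [hs] <;> exact hm _
    · rcases hc with ⟨-, ht⟩ | ⟨-, ht⟩ <;> rw [ht] <;> exact hm _

/-- On a NON-WRAPPING box (`hi_κ + 1 − lo_κ < N_j` for all `κ`), a bond of `T^{(j)}` with both ends in `castSite '' [lo, hi]` is a box bond of pv26's `boxBonds lo hi` (so module 40's
`dist1_dataAxial_le` bounds the re-gauged data there): its source label `x` has `x + e_μ ≤ hi` by injectivity of the projection on `[lo, hi + 1]`. [cite: Balaban1985Variational, (144) p.300 (bookkeeping)] -/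
theorem mem_boxBonds_of_ends_mem_box {lo hi : Fin P.d → ℤ} (hN : ∀ κ, hi κ + 1 - lo κ < P.sitesPerDir j) {c : PBond P j}
    (hs : c.src ∈ (castSite '' Set.Icc lo hi : Set (Site P j))) (ht : c.tgt ∈ (castSite '' Set.Icc lo hi : Set (Site P j))) :
    c ∈ (boxBonds lo hi : Set (PBond P j)) := by
  obtain ⟨x, ⟨hxlo, hxhi⟩, hx⟩ := hs
  obtain ⟨x', ⟨hx'lo, hx'hi⟩, hx'⟩ := ht
  have htgt : c.tgt = castSite (x + e c.dir) := by
    rw [castSite_add_e, hx]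
    rfl
  have heq : x + e c.dir = x' := by
    refine castSite_injOn_box (j := j) (lo := lo) (hi := hi + 1) (fun κ => by have := hN κ; simp only [Pi.add_apply, Pi.one_apply]; omega)
      (fun κ => ?_) (fun κ => ?_) hx'lo (fun κ => ?_) (htgt.symm.trans hx'.symm)
    · have h1 : lo κ ≤ x κ := hxlo κ
      rw [Pi.add_apply, B7Prop1Explicit.e_apply]
      by_cases hκ : κ = c.dir
      · rw [if_pos hκ]; linarith
      · rw [if_neg hκ]; linarith
    · have h1 : x κ ≤ hi κ := hxhi κ
      rw [Pi.add_apply, Pi.add_apply, Pi.one_apply, B7Prop1Explicit.e_apply]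
      by_cases hκ : κ = c.dir
      · rw [if_pos hκ]; linarith
      · rw [if_neg hκ]; linarith
    · have h1 : x' κ ≤ hi κ := hx'hi κ
      simp only [Pi.add_apply, Pi.one_apply]
      omega
  refine ⟨x, hxlo, ?_, hx.symm⟩
  rw [heq]
  exact hx'hi

end Walks

/-! ## §2  Row (r4) on a box, generic averaging family and gauge group -/

section Box

variable {P : Params} {G : Type*} [GaugeGroup G] (av : ∀ i, Averaging P i G)

/-- ★★ **ROW (r4) ON A BOX**: for every `u`, `U₁` and `j ≤ m + K`, if on every bond of `T^{(j)}` with both ends in the box `castSite '' [lo, hi]` the data `M^j(U₁^u)` is `v`-small and the Landau copy's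
average `M^j(U₁)` is `a`-small, then the shear centred at the corner is small on the whole box: `dist1 (g(y₀)⁻¹·g(y)) ≤ (Σ_κ(hi_κ − lo_κ))·(v + a)`, `g := u↾T^{(j)}`, `y₀ := castSite lo` — dag-n07-e's
`dist1_centredShear_le_of_reach` with `hreach := box_reach`. [cite: Balaban1985Variational, (151)–(152) p.301; Balaban1985Averaging, (11) p.19] -/
theorem dist1_centredShear_le_box (u : GaugeTransf P 0 G) (U₁ : GaugeField P 0 G) {j : ℕ} (hj : j ≤ P.m + P.K) {lo hi : Fin P.d → ℤ} {v a : ℝ}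
    (hv0 : 0 ≤ v) (ha0 : 0 ≤ a)
    (hv : ∀ c : PBond P j, c.src ∈ (castSite '' Set.Icc lo hi : Set (Site P j)) → c.tgt ∈ (castSite '' Set.Icc lo hi : Set (Site P j)) →
      dist1 (Averaging.iter av j (gaugeAct u U₁) c) ≤ v)
    (ha : ∀ c : PBond P j, c.src ∈ (castSite '' Set.Icc lo hi : Set (Site P j)) → c.tgt ∈ (castSite '' Set.Icc lo hi : Set (Site P j)) →
      dist1 (Averaging.iter av j U₁ c) ≤ a)
    {y : Site P j} (hy : y ∈ (castSite '' Set.Icc lo hi : Set (Site P j))) :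
    dist1 ((toMS u j (castSite lo))⁻¹ * toMS u j y) ≤ (∑ κ, (hi κ - lo κ).toNat : ℕ) * (v + a) :=
  dist1_centredShear_le_of_reach av u U₁ hj _ (castSite lo) _ hv0 ha0 hv ha box_reach hy

/-- The same with the constraint datum `V` DISPLAYED on the box bonds (`M^j(U₁^u)(c) = V(c)` there; at the record `V = V″`, the axial datum of (149)–(151)).
[cite: Balaban1985Variational, (151) p.301] -/
theorem dist1_centredShear_le_box_data (u : GaugeTransf P 0 G) (U₁ : GaugeField P 0 G) {j : ℕ} (hj : j ≤ P.m + P.K) {lo hi : Fin P.d → ℤ}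
    {V : GaugeField P j G}
    (hV : ∀ c : PBond P j, c.src ∈ (castSite '' Set.Icc lo hi : Set (Site P j)) → c.tgt ∈ (castSite '' Set.Icc lo hi : Set (Site P j)) →
      Averaging.iter av j (gaugeAct u U₁) c = V c)
    {v a : ℝ} (hv0 : 0 ≤ v) (ha0 : 0 ≤ a)
    (hv : ∀ c : PBond P j, c.src ∈ (castSite '' Set.Icc lo hi : Set (Site P j)) → c.tgt ∈ (castSite '' Set.Icc lo hi : Set (Site P j)) → dist1 (V c) ≤ v)
    (ha : ∀ c : PBond P j, c.src ∈ (castSite '' Set.Icc lo hi : Set (Site P j)) → c.tgt ∈ (castSite '' Set.Icc lo hi : Set (Site P j)) →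
      dist1 (Averaging.iter av j U₁ c) ≤ a)
    {y : Site P j} (hy : y ∈ (castSite '' Set.Icc lo hi : Set (Site P j))) :
    dist1 ((toMS u j (castSite lo))⁻¹ * toMS u j y) ≤ (∑ κ, (hi κ - lo κ).toNat : ℕ) * (v + a) :=
  dist1_centredShear_le_of_reach_data av u U₁ hj _ (castSite lo) _ hV hv0 ha0 hv ha box_reach hy

/-- Two box sites: the RELATIVE shear `dist1 (ĝ(y)·ĝ(y′)⁻¹) = dist1 (g(y)·g(y′)⁻¹) ≤ 2·D·(v + a)`. [cite: Balaban1985Variational, (151)–(152) p.301] -/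
theorem dist1_centredShear_rel_le_box (u : GaugeTransf P 0 G) (U₁ : GaugeField P 0 G) {j : ℕ} (hj : j ≤ P.m + P.K) {lo hi : Fin P.d → ℤ} {v a : ℝ}
    (hv0 : 0 ≤ v) (ha0 : 0 ≤ a)
    (hv : ∀ c : PBond P j, c.src ∈ (castSite '' Set.Icc lo hi : Set (Site P j)) → c.tgt ∈ (castSite '' Set.Icc lo hi : Set (Site P j)) →
      dist1 (Averaging.iter av j (gaugeAct u U₁) c) ≤ v)
    (ha : ∀ c : PBond P j, c.src ∈ (castSite '' Set.Icc lo hi : Set (Site P j)) → c.tgt ∈ (castSite '' Set.Icc lo hi : Set (Site P j)) →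
      dist1 (Averaging.iter av j U₁ c) ≤ a)
    {y y' : Site P j} (hy : y ∈ (castSite '' Set.Icc lo hi : Set (Site P j))) (hy' : y' ∈ (castSite '' Set.Icc lo hi : Set (Site P j))) :
    dist1 (((toMS u j (castSite lo))⁻¹ * toMS u j y) * ((toMS u j (castSite lo))⁻¹ * toMS u j y')⁻¹) ≤ 2 * (∑ κ, (hi κ - lo κ).toNat : ℕ) * (v + a) :=
  dist1_centredShear_rel_le av u U₁ hj _ (castSite lo) _ hv0 ha0 hv ha box_reach hy hy'

end Box

/-! ## §3  At the record: `avOfRecord F N K`, `SU(N) ⊂ M_N(ℂ)` -/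

section Record

variable (F : T4Continuum.T4Family) (N : ℕ) [NeZero N]

/-- ★★ **ROW (r4) AT THE RECORD**: for the averaging of record, every torus `K`, level `j ≤ m + K`, every `u`, `U₁` and every box of `T^{(j)}`: bond letters `v` (the data `M^j(U₁^u)`) and `a`
(the Landau copy's averages `M^j(U₁)`) on the box bonds give `dist1 (g(y₀)⁻¹·g(y)) ≤ D·(v + a)` on the box, `g := u↾T^{(j)}`, `y₀ := castSite lo`, `D := Σ_κ(hi_κ − lo_κ)` — at the record `v` is (151)'s
`9dL²Mε₀` (module 40 `dist1_dataAxial_le` on `boxBonds`, door `mem_boxBonds_of_ends_mem_box`) and `a` is (152)'s size of the Landau copy's averages (dag-n07-w2's `norm_chartLog_le_weightedBall`), both DISPLAYED.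
[cite: Balaban1985Variational, (151)–(152) p.301] -/
theorem dist1_centredShear_le_box_record (K : ℕ) (u : GaugeTransf (F.P K) 0 (SU N)) (U₁ : GaugeField (F.P K) 0 (SU N)) {j : ℕ}
    (hj : j ≤ (F.P K).m + (F.P K).K) {lo hi : Fin (F.P K).d → ℤ} {v a : ℝ} (hv0 : 0 ≤ v) (ha0 : 0 ≤ a)
    (hv : ∀ c : PBond (F.P K) j, c.src ∈ (castSite '' Set.Icc lo hi : Set (Site (F.P K) j)) → c.tgt ∈ (castSite '' Set.Icc lo hi : Set (Site (F.P K) j)) →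
      dist1 (Averaging.iter (avOfRecord F N K) j (gaugeAct u U₁) c) ≤ v)
    (ha : ∀ c : PBond (F.P K) j, c.src ∈ (castSite '' Set.Icc lo hi : Set (Site (F.P K) j)) → c.tgt ∈ (castSite '' Set.Icc lo hi : Set (Site (F.P K) j)) →
      dist1 (Averaging.iter (avOfRecord F N K) j U₁ c) ≤ a)
    {y : Site (F.P K) j} (hy : y ∈ (castSite '' Set.Icc lo hi : Set (Site (F.P K) j))) :
    dist1 ((toMS u j (castSite lo))⁻¹ * toMS u j y) ≤ (∑ κ, (hi κ - lo κ).toNat : ℕ) * (v + a) :=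
  dist1_centredShear_le_box (avOfRecord F N K) u U₁ hj hv0 ha0 hv ha hy

/-- ★ **Log letters of the centred shear at the record**: once `D·(v + a) ≤ ½`, `‖log ĝ(y)‖ ≤ 2·D·(v + a)` on the box (`MatrixLog.norm_mlog_le_two_mul`; `dist1 = ‖· − 1‖_op` on `SU(N)`, `UnitaryModel`) —
the letter `ℓ` of dag-n07-w7's BCH row, `‖X‖, ‖Z‖ ≤ ℓ`. [cite: Balaban1985Variational, (152) p.301; Balaban1985Averaging, (21) p.21] -/
theorem norm_mlog_centredShear_le_box_record (K : ℕ) (u : GaugeTransf (F.P K) 0 (SU N)) (U₁ : GaugeField (F.P K) 0 (SU N)) {j : ℕ}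
    (hj : j ≤ (F.P K).m + (F.P K).K) {lo hi : Fin (F.P K).d → ℤ} {v a : ℝ} (hv0 : 0 ≤ v) (ha0 : 0 ≤ a)
    (hv : ∀ c : PBond (F.P K) j, c.src ∈ (castSite '' Set.Icc lo hi : Set (Site (F.P K) j)) → c.tgt ∈ (castSite '' Set.Icc lo hi : Set (Site (F.P K) j)) →
      dist1 (Averaging.iter (avOfRecord F N K) j (gaugeAct u U₁) c) ≤ v)
    (ha : ∀ c : PBond (F.P K) j, c.src ∈ (castSite '' Set.Icc lo hi : Set (Site (F.P K) j)) → c.tgt ∈ (castSite '' Set.Icc lo hi : Set (Site (F.P K) j)) →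
      dist1 (Averaging.iter (avOfRecord F N K) j U₁ c) ≤ a)
    (hsmall : ((∑ κ, (hi κ - lo κ).toNat : ℕ) : ℝ) * (v + a) ≤ 1 / 2)
    {y : Site (F.P K) j} (hy : y ∈ (castSite '' Set.Icc lo hi : Set (Site (F.P K) j))) :
    ‖mlog ((((toMS u j (castSite lo))⁻¹ * toMS u j y : SU N)) : MatA N)‖ ≤ 2 * ((∑ κ, (hi κ - lo κ).toNat : ℕ) * (v + a)) := by
  have h := dist1_centredShear_le_box_record F N K u U₁ hj hv0 ha0 hv ha hy
  have h' : ‖((((toMS u j (castSite lo))⁻¹ * toMS u j y : SU N)) : MatA N) - 1‖ ≤ ((∑ κ, (hi κ - lo κ).toNat : ℕ) : ℝ) * (v + a) := h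
  exact (norm_mlog_le_two_mul (h'.trans hsmall)).trans (by linarith)

/-- ★ **ROW (r4) AT THE RECORD, intrinsic edition** (dag-n07-e's §4 `centredShear_eq_shearRIter_rel` with p608036's discharges of `h𝓔`∕`hctr`): under the block axial gauges of `M^i(U₁^u)`, `i < j`, for the contour datum
of record and the (81)∕(1.29) normalisation `R̄ʲu = 1` at the corner `y₀ = castSite lo` and at `y`, the intrinsic factors of [3] (85) satisfy `dist1 (S_j(U₁)(y₀)·S_j(U₁)(y)⁻¹) ≤ D·(v + a)` — p609211's `λ_j = log S_j(U₁)` letters are covariantly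
almost constant on the box. [cite: Balaban1985Averaging, (85)–(87) p.31; Balaban1985Variational, (151)–(152) p.301] -/
theorem dist1_shearRIter_rel_le_box_record (K : ℕ) {u : GaugeTransf (F.P K) 0 (SU N)} {U₁ : GaugeField (F.P K) 0 (SU N)} {j : ℕ}
    (hj : j ≤ (F.P K).m + (F.P K).K)
    (hax : ∀ i < j, AxialGauge (contourOfRecord F N K i) (Averaging.iter (avOfRecord F N K) i (gaugeAct u U₁)))
    {lo hi : Fin (F.P K).d → ℤ} {v a : ℝ} (hv0 : 0 ≤ v) (ha0 : 0 ≤ a)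
    (hv : ∀ c : PBond (F.P K) j, c.src ∈ (castSite '' Set.Icc lo hi : Set (Site (F.P K) j)) → c.tgt ∈ (castSite '' Set.Icc lo hi : Set (Site (F.P K) j)) →
      dist1 (Averaging.iter (avOfRecord F N K) j (gaugeAct u U₁) c) ≤ v)
    (ha : ∀ c : PBond (F.P K) j, c.src ∈ (castSite '' Set.Icc lo hi : Set (Site (F.P K) j)) → c.tgt ∈ (castSite '' Set.Icc lo hi : Set (Site (F.P K) j)) →
      dist1 (Averaging.iter (avOfRecord F N K) j U₁ c) ≤ a)
    (h0 : gaugeAvgIter (loopAvgBlockOp expMeanLogSU) u j (castSite lo) = 1)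
    {y : Site (F.P K) j} (hyn : gaugeAvgIter (loopAvgBlockOp expMeanLogSU) u j y = 1) (hy : y ∈ (castSite '' Set.Icc lo hi : Set (Site (F.P K) j))) :
    dist1 (shearRIter (avOfRecord F N K) (contourOfRecord F N K) (loopAvgBlockOp expMeanLogSU) U₁ j (castSite lo) *
        (shearRIter (avOfRecord F N K) (contourOfRecord F N K) (loopAvgBlockOp expMeanLogSU) U₁ j y)⁻¹) ≤ (∑ κ, (hi κ - lo κ).toNat : ℕ) * (v + a) := by
  rw [← centredShear_eq_shearRIter_rel (avOfRecord F N K) (contourOfRecord F N K) (loopAvgBlockOp expMeanLogSU)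
    (loopAvgBlockOp_local expMeanLogSU) (holTo_contourOfRecord_emb F N K) hj hax h0 hyn]
  exact dist1_centredShear_le_box_record F N K u U₁ hj hv0 ha0 hv ha hy

end Record

/-! ## §4  Rows (r1) + (r4) composed at the record: the sheared datum in logarithmic letters with every shear letter supplied -/

section Composed

variable (F : T4Continuum.T4Family) (N : ℕ) [NeZero N]

omit [NeZero N] in
/-- Bookkeeping: for `SU(N)`-valued `a, w, b`, the three-factor product `a⁻¹·w·b` as matrices through the units `(ιSU a)⁻¹`, `((ιSU b)⁻¹)⁻¹` (dag-n07-w7's `Sm·V·Sp⁻¹` shape with `Sm := a⁻¹`, `Sp := b⁻¹`).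
[cite: Balaban1985Averaging, (8) p.18 (bookkeeping)] -/
theorem coe_inv_mul_mul (a w b : SU N) :
    (((a⁻¹ * w * b : SU N)) : MatA N) = (((ιSU N a)⁻¹ : (MatA N)ˣ) : MatA N) * (w : MatA N) * ((((ιSU N b)⁻¹)⁻¹ : (MatA N)ˣ) : MatA N) := by
  rw [inv_inv, ← map_inv]
  rfl

/-- ★★★ **ROWS (r1) + (r4) AT THE RECORD — the sheared datum of the Landau copy in logarithmic letters, shear letters SUPPLIED.**  Averaging of record, torus `K`, level `j ≤ m + K`, any `u`, `U₁`, a box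
`[lo, hi]` of `T^{(j)}` with corner `y₀ = castSite lo` and `D := Σ_κ(hi_κ − lo_κ)`; bond letters on the box: `dist1 M^j(U₁^u)(c) ≤ v` (data) and `dist1 M^j(U₁)(c) ≤ a` (Landau copy), with `σ♮ := D·(v + a) ≤ 1∕80` and
`v ≤ 1∕40`.  Then on every bond `c` with both ends in the box, with `g := u↾T^{(j)}`, `g₀ := g(y₀)`, `ĝ := g₀⁻¹g`, `V♮(c) := g₀⁻¹·M^j(U₁^u)(c)·g₀`:
`‖log M^j(U₁)(c) − (log V♮(c) + (log ĝ(c₋)⁻¹ − log ĝ(c₊)⁻¹))‖ ≤ 8σ♮² + 20σ♮v` — dag-n07-e's centred identity `iter_apply_eq_centredShear` + dag-n07-w7's `norm_mlog_conj_shear_sub_le` with `‖ĝ(c∓)⁻¹ − 1‖ = dist1 ĝ(c∓) ≤ σ♮`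
(§2) and `‖V♮(c) − 1‖ = dist1 M^j(U₁^u)(c) ≤ v` (`dist1_const_conj`). [cite: Balaban1985Variational, (152)–(156) pp.301–302, (164) p.303; Balaban1985Averaging, (31) p.22, (85)–(88) p.31] -/
theorem norm_mlog_iter_avOfRecord_centred_sub_le (K : ℕ) (u : GaugeTransf (F.P K) 0 (SU N)) (U₁ : GaugeField (F.P K) 0 (SU N)) {j : ℕ}
    (hj : j ≤ (F.P K).m + (F.P K).K) {lo hi : Fin (F.P K).d → ℤ} {v a : ℝ} (hv0 : 0 ≤ v) (ha0 : 0 ≤ a)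
    (hv : ∀ c : PBond (F.P K) j, c.src ∈ (castSite '' Set.Icc lo hi : Set (Site (F.P K) j)) → c.tgt ∈ (castSite '' Set.Icc lo hi : Set (Site (F.P K) j)) →
      dist1 (Averaging.iter (avOfRecord F N K) j (gaugeAct u U₁) c) ≤ v)
    (ha : ∀ c : PBond (F.P K) j, c.src ∈ (castSite '' Set.Icc lo hi : Set (Site (F.P K) j)) → c.tgt ∈ (castSite '' Set.Icc lo hi : Set (Site (F.P K) j)) →
      dist1 (Averaging.iter (avOfRecord F N K) j U₁ c) ≤ a)
    (hσ : ((∑ κ, (hi κ - lo κ).toNat : ℕ) : ℝ) * (v + a) ≤ 1 / 80) (hv40 : v ≤ 1 / 40)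
    {c : PBond (F.P K) j} (hs : c.src ∈ (castSite '' Set.Icc lo hi : Set (Site (F.P K) j))) (ht : c.tgt ∈ (castSite '' Set.Icc lo hi : Set (Site (F.P K) j))) :
    ‖mlog ((Averaging.iter (avOfRecord F N K) j U₁ c : SU N) : MatA N) -
        (mlog ((((toMS u j (castSite lo))⁻¹ * Averaging.iter (avOfRecord F N K) j (gaugeAct u U₁) c * toMS u j (castSite lo) : SU N)) : MatA N) +
          (mlog (((((toMS u j (castSite lo))⁻¹ * toMS u j c.src)⁻¹ : SU N)) : MatA N) -
            mlog (((((toMS u j (castSite lo))⁻¹ * toMS u j c.tgt)⁻¹ : SU N)) : MatA N)))‖ ≤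
      8 * (((∑ κ, (hi κ - lo κ).toNat : ℕ) : ℝ) * (v + a)) ^ 2 + 20 * (((∑ κ, (hi κ - lo κ).toNat : ℕ) : ℝ) * (v + a)) * v := by
  -- the centred identity (dag-n07-e §2), with `g₀ := g(y₀)`
  have hid := iter_apply_eq_centredShear (avOfRecord F N K) u U₁ hj (V := Averaging.iter (avOfRecord F N K) j (gaugeAct u U₁)) (c := c) rfl
    (toMS u j (castSite lo))
  rw [hid, coe_inv_mul_mul]
  -- the shear letters
  have hsrc := dist1_centredShear_le_box_record F N K u U₁ hj hv0 ha0 hv ha hs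
  have htgt := dist1_centredShear_le_box_record F N K u U₁ hj hv0 ha0 hv ha ht
  refine norm_mlog_conj_shear_sub_le _ _ _ hσ hv40 ?_ ?_ ?_
  · -- `‖ĝ(c₋)⁻¹ − 1‖ = dist1 ĝ(c₋)`
    have e : ((((ιSU N ((toMS u j (castSite lo))⁻¹ * toMS u j c.src))⁻¹ : (MatA N)ˣ)) : MatA N) =
        star ((((toMS u j (castSite lo))⁻¹ * toMS u j c.src : SU N)) : MatA N) := by
      rw [← map_inv]; rfl
    rw [e, ExpMeanLog.norm_star_sub_one]
    exact hsrc
  · have e : ((((ιSU N ((toMS u j (castSite lo))⁻¹ * toMS u j c.tgt))⁻¹ : (MatA N)ˣ)) : MatA N) =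
        star ((((toMS u j (castSite lo))⁻¹ * toMS u j c.tgt : SU N)) : MatA N) := by
      rw [← map_inv]; rfl
    rw [e, ExpMeanLog.norm_star_sub_one]
    exact htgt
  · -- `‖V♮(c) − 1‖ = dist1 M^j(U₁^u)(c) ≤ v`
    have hc := hv c hs ht
    have e := dist1_const_conj (toMS u j (castSite lo)) (Averaging.iter (avOfRecord F N K) j (gaugeAct u U₁) c)
    have h' : dist1 ((toMS u j (castSite lo))⁻¹ * Averaging.iter (avOfRecord F N K) j (gaugeAct u U₁) c * toMS u j (castSite lo)) ≤ v := by
      rw [e]; exact hc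
    exact h'

end Composed

/-! ## §5  (v1.1, A6) Non-vacuity: at the unit configuration every hypothesis of the composed row holds with `v = a = σ♮ = 0`, and the remainder bound is `0` -/

section NonVacuity

variable (F : T4Continuum.T4Family) (N : ℕ) [NeZero N]

/-- The bond letters of §2–§4 are inhabited at the unit configuration with `v = 0`: `dist1 M^j(1^1)(c) = 0` on every bond (`B15Claim189UnitTestAtRecord.iter_avOfRecord_one`, `gaugeAct_one'`,
`dist1_one`). [cite: Balaban1985Variational, (151) p.301 (bookkeeping)] -/
theorem dist1_iter_avOfRecord_gaugeAct_one (K j : ℕ) (c : PBond (F.P K) j) :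
    dist1 (Averaging.iter (avOfRecord F N K) j (gaugeAct (fun _ => (1 : SU N)) (1 : GaugeField (F.P K) 0 (SU N))) c) ≤ 0 := by
  rw [B12RTGaugeInvariance254.gaugeAct_one', B15Claim189UnitTestAtRecord.iter_avOfRecord_one F N K j]
  exact le_of_eq (GaugeGroup.dist1_one)

/-- … and with `a = 0`: `dist1 M^j(1)(c) = 0`. [cite: Balaban1985Variational, (152) p.301 (bookkeeping)] -/
theorem dist1_iter_avOfRecord_one (K j : ℕ) (c : PBond (F.P K) j) :
    dist1 (Averaging.iter (avOfRecord F N K) j (1 : GaugeField (F.P K) 0 (SU N)) c) ≤ 0 := by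
  rw [B15Claim189UnitTestAtRecord.iter_avOfRecord_one F N K j]
  exact le_of_eq (GaugeGroup.dist1_one)

/-- ★ **A6 NON-VACUITY of rows (r1)+(r4) at the record**: at `U₁ = 1`, `u = 1`, on ANY box of `T^{(j)}` (`j ≤ m + K`), every hypothesis of `norm_mlog_iter_avOfRecord_centred_sub_le` holds with
`v = a = 0` (hence `σ♮ = D·(v + a) = 0 ≤ 1∕80`), and the conclusion reads with remainder bound `8·0² + 20·0·0 = 0` — the composed row is inhabited and TIGHT at the unit configuration.
[cite: Balaban1985Variational, (152)–(156) pp.301–302] -/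
theorem norm_mlog_iter_avOfRecord_centred_sub_le_one (K : ℕ) {j : ℕ} (hj : j ≤ (F.P K).m + (F.P K).K) (lo hi : Fin (F.P K).d → ℤ)
    {c : PBond (F.P K) j} (hs : c.src ∈ (castSite '' Set.Icc lo hi : Set (Site (F.P K) j))) (ht : c.tgt ∈ (castSite '' Set.Icc lo hi : Set (Site (F.P K) j))) :
    ‖mlog ((Averaging.iter (avOfRecord F N K) j (1 : GaugeField (F.P K) 0 (SU N)) c : SU N) : MatA N) -
        (mlog ((((toMS (fun _ => (1 : SU N)) j (castSite lo))⁻¹ *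
              Averaging.iter (avOfRecord F N K) j (gaugeAct (fun _ => (1 : SU N)) (1 : GaugeField (F.P K) 0 (SU N))) c *
                toMS (fun _ => (1 : SU N)) j (castSite lo) : SU N)) : MatA N) +
          (mlog (((((toMS (fun _ => (1 : SU N)) j (castSite lo))⁻¹ * toMS (fun _ => (1 : SU N)) j c.src)⁻¹ : SU N)) : MatA N) -
            mlog (((((toMS (fun _ => (1 : SU N)) j (castSite lo))⁻¹ * toMS (fun _ => (1 : SU N)) j c.tgt)⁻¹ : SU N)) : MatA N)))‖ ≤
      8 * (((∑ κ, (hi κ - lo κ).toNat : ℕ) : ℝ) * ((0 : ℝ) + 0)) ^ 2 + 20 * (((∑ κ, (hi κ - lo κ).toNat : ℕ) : ℝ) * ((0 : ℝ) + 0)) * 0 :=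
  norm_mlog_iter_avOfRecord_centred_sub_le F N K (fun _ => (1 : SU N)) (1 : GaugeField (F.P K) 0 (SU N)) hj le_rfl le_rfl
    (fun c _ _ => dist1_iter_avOfRecord_gaugeAct_one F N K j c) (fun c _ _ => dist1_iter_avOfRecord_one F N K j c)
    (by simp) (by norm_num) hs ht

end NonVacuity

end Summit.QuantumFields.YangMills.BalabanUVNodes.N07ShearSizeTopBox
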